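import Mathlib
import HarnessLib
import Literature.Analysis.FluidPDE.LeraySchemePressure
import Literature.Analysis.FluidPDE.AxisymNoSwirlVorticity
import Literature.Analysis.FluidPDE.TypeIAncientMildClassical
import Summits.NavierStokesRegularity.NavierStokesRegularity.Theorems.PoloidalWindowDoorPoloidalWindowRigidityWindow
import Summits.NavierStokesRegularity.NavierStokesRegularity.Theorems.PoloidalWindowDoorPoloidalWindowRigidityEquipartition

/-!
# K2 `PoloidalWindowRigidity` (stmt-NavierStokesRegularity-19708) — PRESSURE BY REGIME:
# `−Δp = |D_h v_h|²_F + (div_h v_h)² + 2m |∇_h v₂|²` on the poloidal frozen class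

Cell ns-regularity-ideate, seat nsreg-p7 gen 7 (third worker under the K2 lead ns-poloidal-K2-p1; the lead's wish-list
K2P1-M11-NOTES §1(c)/§4(c) «`…PressureRegime` as a Theorems identity + the superharmonicity corollary on the elliptic
stratum»).  Indices `0, 1` horizontal, `2` vertical; `∂ⱼvᵢ = Dv(x)(eⱼ)ᵢ`.

* `trace_sq_of_poloidal_shear` — pointwise algebra: for a linear `L` (= `Dv(x)`) with `tr L = 0` (incompressible),
  `L(e₀)₁ = L(e₁)₀` (POLOIDAL: `ω₂ = ∂₀v₁ − ∂₁v₀ = 0`) and `L(e₂)_b = m L(e_b)₂`, `b = 0,1` (FROZEN with shear ratio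
  `m`: `∂₂v_h = m ∇_h v₂`, `m = 1 − 1/Λ` off the critical set, `Λ` the Clebsch slope):
  `tr(L²) = Σᵢ⟪eᵢ, L(L eᵢ)⟫ = (∂₀v₀)² + (∂₁v₁)² + 2(∂₁v₀)² + (∂₀v₀ + ∂₁v₁)² + 2m(|∂₀v₂|² + |∂₁v₂|²)`
  (`= |D_h v_h|²_F + (div_h v_h)² + 2m|∇_h v₂|²`; in slope form the last term is `2Λ(Λ−1)|ω|²`).
* `neg_laplacian_pressure_eq_of_poloidal_shear` — for ANY classical Navier–Stokes solution `(v, p)` (viscosity `ν`,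
  zero force) on an open time set, at a time `s` and a point `x` where the slice is poloidal with shear ratio `m(x)`:
  `−Δp(s)(x) =` the right-hand side above (pressure Poisson equation `Δp = −div((v·∇)v) = −tr((Dv)²)`, tree
  `laplacian_pressure_eq_of_isClassicalNSSolutionOn` + `divergence_convect_eq_sum`).
* `laplacian_pressure_nonpos_of_shear_nonneg` — ELLIPTIC REGIME ⇒ SUPERHARMONIC PRESSURE: `m(x) ≥ 0 ⇒ Δp(s)(x) ≤ 0`,
  indeed `−Δp ≥ |D_h v_h|²_F + (div_h v_h)²`; the vorticity enters `−Δp` only through `2m|∇_h v₂|²`, so the pressure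
  can be subharmonic only in the hyperbolic (vorticity-dominated) regime `m < 0 ⇔ Λ ∈ (0,1)`.
* `neg_laplacian_pressure_eq_of_class` / `laplacian_pressure_nonpos_of_elliptic_slice` /
  `exists_pressure_superharmonic_of_class` — the same on a window `(t₀, 0)`, and for a profile of the route's Type-I
  class with the classical pressure the tree provides (`IsTypeIAncientMild.exists_isClassicalNSSolutionOn_Ioo`).

WHAT THIS IS NOT: not a claim about Navier–Stokes regularity and not the crux — the pressure portrait of the residue
S2⁗ by regime (bears_on LADDER-NS N0, route PoloidalWindowDoor, crux K2; `--supports` the K2 item).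
-/

noncomputable section

-- the summit and its single sub-problem share the name (CONVENTIONS §1), as in every Theorems file
set_option linter.dupNamespace false

namespace Summit.NavierStokesRegularity.NavierStokesRegularity.Theorems.PoloidalWindowDoorPoloidalWindowRigidityPressureRegime

open MeasureTheory Set Function Filter Topology Metric InnerProductSpace
open scoped RealInnerProductSpace Laplacian
open Literature.Analysis Literature.Analysis.FluidPDE
open Summit.NavierStokesRegularity.NavierStokesRegularity.Theorems.PoloidalWindowDoorPoloidalWindowRigidityWindow
open Summit.NavierStokesRegularity.NavierStokesRegularity.Theorems.PoloidalWindowDoorPoloidalWindowRigidityEquipartition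

/-! ### pointwise algebra -/

/-- **`tr((Dv)²)` on the poloidal frozen class.**  For a linear map `L` of `ℝ³` with `Σᵢ L(eᵢ)ᵢ = 0`,
`L(e₀)₁ = L(e₁)₀` and `L(e₂)_b = m · L(e_b)₂` (`b = 0, 1`):
`Σᵢ ⟪eᵢ, L(L eᵢ)⟫ = L(e₀)₀² + L(e₁)₁² + 2 L(e₀)₁² + (L(e₀)₀ + L(e₁)₁)² + 2m (L(e₀)₂² + L(e₁)₂²)`. -/
theorem trace_sq_of_poloidal_shear (L : EuclideanSpace ℝ (Fin 3) →L[ℝ] EuclideanSpace ℝ (Fin 3)) {m : ℝ}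
    (hdiv : L (EuclideanSpace.single 0 (1 : ℝ)) 0 + L (EuclideanSpace.single 1 (1 : ℝ)) 1 +
      L (EuclideanSpace.single 2 (1 : ℝ)) 2 = 0)
    (hω : L (EuclideanSpace.single 0 (1 : ℝ)) 1 = L (EuclideanSpace.single 1 (1 : ℝ)) 0)
    (h0 : L (EuclideanSpace.single 2 (1 : ℝ)) 0 = m * L (EuclideanSpace.single 0 (1 : ℝ)) 2)
    (h1 : L (EuclideanSpace.single 2 (1 : ℝ)) 1 = m * L (EuclideanSpace.single 1 (1 : ℝ)) 2) :
    ∑ i : Fin 3, ⟪(EuclideanSpace.single i (1 : ℝ) : EuclideanSpace ℝ (Fin 3)), L (L (EuclideanSpace.single i (1 : ℝ)))⟫ =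
      L (EuclideanSpace.single 0 (1 : ℝ)) 0 ^ 2 + L (EuclideanSpace.single 1 (1 : ℝ)) 1 ^ 2 +
        2 * L (EuclideanSpace.single 0 (1 : ℝ)) 1 ^ 2 +
        (L (EuclideanSpace.single 0 (1 : ℝ)) 0 + L (EuclideanSpace.single 1 (1 : ℝ)) 1) ^ 2 +
        2 * m * (L (EuclideanSpace.single 0 (1 : ℝ)) 2 ^ 2 + L (EuclideanSpace.single 1 (1 : ℝ)) 2 ^ 2) := by
  have h2 : L (EuclideanSpace.single 2 (1 : ℝ)) 2 =
      -(L (EuclideanSpace.single 0 (1 : ℝ)) 0 + L (EuclideanSpace.single 1 (1 : ℝ)) 1) := by linarith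
  simp only [Fin.sum_univ_three, EuclideanSpace.inner_single_left, map_one, one_mul]
  rw [clm_apply_coord_eq_sum L (L (EuclideanSpace.single 0 (1 : ℝ))) 0,
    clm_apply_coord_eq_sum L (L (EuclideanSpace.single 1 (1 : ℝ))) 1,
    clm_apply_coord_eq_sum L (L (EuclideanSpace.single 2 (1 : ℝ))) 2]
  simp only [Fin.sum_univ_three]
  rw [hω, h0, h1, h2]
  ring

/-- Nonnegativity of the strain part: with `m ≥ 0` the right-hand side of `trace_sq_of_poloidal_shear` is `≥ 0`. -/
theorem trace_sq_nonneg_of_poloidal_shear (L : EuclideanSpace ℝ (Fin 3) →L[ℝ] EuclideanSpace ℝ (Fin 3)) {m : ℝ}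
    (hm : 0 ≤ m)
    (hdiv : L (EuclideanSpace.single 0 (1 : ℝ)) 0 + L (EuclideanSpace.single 1 (1 : ℝ)) 1 +
      L (EuclideanSpace.single 2 (1 : ℝ)) 2 = 0)
    (hω : L (EuclideanSpace.single 0 (1 : ℝ)) 1 = L (EuclideanSpace.single 1 (1 : ℝ)) 0)
    (h0 : L (EuclideanSpace.single 2 (1 : ℝ)) 0 = m * L (EuclideanSpace.single 0 (1 : ℝ)) 2)
    (h1 : L (EuclideanSpace.single 2 (1 : ℝ)) 1 = m * L (EuclideanSpace.single 1 (1 : ℝ)) 2) :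
    0 ≤ ∑ i : Fin 3, ⟪(EuclideanSpace.single i (1 : ℝ) : EuclideanSpace ℝ (Fin 3)), L (L (EuclideanSpace.single i (1 : ℝ)))⟫ := by
  rw [trace_sq_of_poloidal_shear L hdiv hω h0 h1]
  positivity

/-! ### the pressure Poisson equation by regime -/

variable {S : Set ℝ} {ν : ℝ} {v : ℝ → EuclideanSpace ℝ (Fin 3) → EuclideanSpace ℝ (Fin 3)}
  {p : ℝ → EuclideanSpace ℝ (Fin 3) → ℝ}

/-- `Δp = −tr((Dv)²)` in the standard frame, for a classical Navier–Stokes solution (any viscosity, zero force) at an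
interior time. -/
theorem laplacian_pressure_eq_neg_sum (hcl : IsClassicalNSSolutionOn S ν 0 v p) {s : ℝ} (hs : s ∈ interior S)
    (x : EuclideanSpace ℝ (Fin 3)) :
    (Δ (p s)) x = -∑ i : Fin 3, ⟪(EuclideanSpace.single i (1 : ℝ) : EuclideanSpace ℝ (Fin 3)),
      fderiv ℝ (v s) x (fderiv ℝ (v s) x (EuclideanSpace.single i (1 : ℝ)))⟫ := by
  have hsS : s ∈ S := interior_subset hs
  have hv2 : ContDiff ℝ 2 (v s) := (hcl.contDiff_velocity hsS).of_le (by norm_cast)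
  have hv1 : ContDiff ℝ 1 (v s) := (hcl.contDiff_velocity hsS).of_le (by norm_cast)
  rw [laplacian_pressure_eq_of_isClassicalNSSolutionOn hcl hs x,
    divergence_convect_eq_sum (EuclideanSpace.basisFun (Fin 3) ℝ) hv2 hv1 (hcl.divFree s hsS) x]
  simp [EuclideanSpace.basisFun_apply, VectorCalculus.divergence]

/-- **PRESSURE BY REGIME.**  For a classical Navier–Stokes solution `(v, p)` (any viscosity, zero force) on a time set
`S`, an interior time `s` and a point `x` at which the slice is poloidal (`(curl v(s))(x)₂ = 0`) with shear ratio
`m(x)` (`∂₂v_b(x) = m(x) ∂_b v₂(x)`, `b = 0,1`):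
`−Δp(s)(x) = (∂₀v₀)² + (∂₁v₁)² + 2(∂₁v₀)² + (∂₀v₀ + ∂₁v₁)² + 2m(x)(|∂₀v₂|² + |∂₁v₂|²)`. -/
theorem neg_laplacian_pressure_eq_of_poloidal_shear (hcl : IsClassicalNSSolutionOn S ν 0 v p) {s : ℝ}
    (hs : s ∈ interior S) {x : EuclideanSpace ℝ (Fin 3)} (hpol : curl (v s) x 2 = 0) {m : ℝ}
    (h0 : fderiv ℝ (v s) x (EuclideanSpace.single 2 1) 0 = m * fderiv ℝ (v s) x (EuclideanSpace.single 0 1) 2)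
    (h1 : fderiv ℝ (v s) x (EuclideanSpace.single 2 1) 1 = m * fderiv ℝ (v s) x (EuclideanSpace.single 1 1) 2) :
    -(Δ (p s)) x =
      fderiv ℝ (v s) x (EuclideanSpace.single 0 1) 0 ^ 2 + fderiv ℝ (v s) x (EuclideanSpace.single 1 1) 1 ^ 2 +
        2 * fderiv ℝ (v s) x (EuclideanSpace.single 0 1) 1 ^ 2 +
        (fderiv ℝ (v s) x (EuclideanSpace.single 0 1) 0 + fderiv ℝ (v s) x (EuclideanSpace.single 1 1) 1) ^ 2 +
        2 * m * (fderiv ℝ (v s) x (EuclideanSpace.single 0 1) 2 ^ 2 + fderiv ℝ (v s) x (EuclideanSpace.single 1 1) 2 ^ 2) := by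
  have hsS : s ∈ S := interior_subset hs
  -- incompressibility in coordinates and `ω₂ = 0`
  have hdiv : fderiv ℝ (v s) x (EuclideanSpace.single 0 1) 0 + fderiv ℝ (v s) x (EuclideanSpace.single 1 1) 1 +
      fderiv ℝ (v s) x (EuclideanSpace.single 2 1) 2 = 0 := by
    have h := hcl.divFree s hsS x
    rw [divergence_eq_sum_inner_fderiv (EuclideanSpace.basisFun (Fin 3) ℝ)] at h
    simpa [Fin.sum_univ_three, EuclideanSpace.basisFun_apply, EuclideanSpace.inner_single_left] using h
  have hω : fderiv ℝ (v s) x (EuclideanSpace.single 0 1) 1 = fderiv ℝ (v s) x (EuclideanSpace.single 1 1) 0 := by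
    rw [curl_apply_two] at hpol
    linarith
  rw [laplacian_pressure_eq_neg_sum hcl hs x, neg_neg, trace_sq_of_poloidal_shear (fderiv ℝ (v s) x) hdiv hω h0 h1]

/-- **ELLIPTIC REGIME ⇒ SUPERHARMONIC PRESSURE.**  In the situation of
`neg_laplacian_pressure_eq_of_poloidal_shear`, if the shear ratio is nonnegative at `x` (strain-dominated or
parabolic vortex-normal plane, `Λ ∉ (0,1)`), then `Δp(s)(x) ≤ 0`; indeed `−Δp ≥ |D_h v_h|²_F + (div_h v_h)²`. -/
theorem laplacian_pressure_nonpos_of_shear_nonneg (hcl : IsClassicalNSSolutionOn S ν 0 v p) {s : ℝ}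
    (hs : s ∈ interior S) {x : EuclideanSpace ℝ (Fin 3)} (hpol : curl (v s) x 2 = 0) {m : ℝ} (hm : 0 ≤ m)
    (h0 : fderiv ℝ (v s) x (EuclideanSpace.single 2 1) 0 = m * fderiv ℝ (v s) x (EuclideanSpace.single 0 1) 2)
    (h1 : fderiv ℝ (v s) x (EuclideanSpace.single 2 1) 1 = m * fderiv ℝ (v s) x (EuclideanSpace.single 1 1) 2) :
    (Δ (p s)) x ≤ 0 := by
  have h := neg_laplacian_pressure_eq_of_poloidal_shear hcl hs hpol h0 h1
  have hnn : 0 ≤ -(Δ (p s)) x := by rw [h]; positivity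
  linarith

/-- The strain lower bound in the elliptic regime: `|D_h v_h|²_F + (div_h v_h)² ≤ −Δp(s)(x)` when `m(x) ≥ 0`. -/
theorem horizontalStrain_sq_le_neg_laplacian_pressure (hcl : IsClassicalNSSolutionOn S ν 0 v p) {s : ℝ}
    (hs : s ∈ interior S) {x : EuclideanSpace ℝ (Fin 3)} (hpol : curl (v s) x 2 = 0) {m : ℝ} (hm : 0 ≤ m)
    (h0 : fderiv ℝ (v s) x (EuclideanSpace.single 2 1) 0 = m * fderiv ℝ (v s) x (EuclideanSpace.single 0 1) 2)
    (h1 : fderiv ℝ (v s) x (EuclideanSpace.single 2 1) 1 = m * fderiv ℝ (v s) x (EuclideanSpace.single 1 1) 2) :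
    fderiv ℝ (v s) x (EuclideanSpace.single 0 1) 0 ^ 2 + fderiv ℝ (v s) x (EuclideanSpace.single 1 1) 1 ^ 2 +
        2 * fderiv ℝ (v s) x (EuclideanSpace.single 0 1) 1 ^ 2 +
        (fderiv ℝ (v s) x (EuclideanSpace.single 0 1) 0 + fderiv ℝ (v s) x (EuclideanSpace.single 1 1) 1) ^ 2 ≤
      -(Δ (p s)) x := by
  rw [neg_laplacian_pressure_eq_of_poloidal_shear hcl hs hpol h0 h1]
  have : 0 ≤ 2 * m * (fderiv ℝ (v s) x (EuclideanSpace.single 0 1) 2 ^ 2 +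
      fderiv ℝ (v s) x (EuclideanSpace.single 1 1) 2 ^ 2) := by positivity
  linarith

/-! ### on the route's Type-I class -/

variable {C : ℝ}

/-- **PRESSURE BY REGIME ON THE CLASS.**  For a profile of the route's Type-I class, any classical pressure `p` of it on a
window `(t₀, 0)`, a slice `s ∈ (t₀, 0)` poloidal along `e₂`, and a point `x` with shear ratio `m`:
`−Δp(s)(x) = |D_h v_h|²_F + (div_h v_h)² + 2m|∇_h v₂|²` (coordinates as in
`neg_laplacian_pressure_eq_of_poloidal_shear`). -/
theorem neg_laplacian_pressure_eq_of_class {t₀ : ℝ} (hcl : IsClassicalNSSolutionOn (Ioo t₀ 0) 1 0 v p) {s : ℝ}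
    (hs : s ∈ Ioo t₀ 0) (hpol : ∀ y, ⟪curl (v s) y, EuclideanSpace.single 2 1⟫ = 0)
    {x : EuclideanSpace ℝ (Fin 3)} {m : ℝ}
    (h0 : fderiv ℝ (v s) x (EuclideanSpace.single 2 1) 0 = m * fderiv ℝ (v s) x (EuclideanSpace.single 0 1) 2)
    (h1 : fderiv ℝ (v s) x (EuclideanSpace.single 2 1) 1 = m * fderiv ℝ (v s) x (EuclideanSpace.single 1 1) 2) :
    -(Δ (p s)) x =
      fderiv ℝ (v s) x (EuclideanSpace.single 0 1) 0 ^ 2 + fderiv ℝ (v s) x (EuclideanSpace.single 1 1) 1 ^ 2 +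
        2 * fderiv ℝ (v s) x (EuclideanSpace.single 0 1) 1 ^ 2 +
        (fderiv ℝ (v s) x (EuclideanSpace.single 0 1) 0 + fderiv ℝ (v s) x (EuclideanSpace.single 1 1) 1) ^ 2 +
        2 * m * (fderiv ℝ (v s) x (EuclideanSpace.single 0 1) 2 ^ 2 + fderiv ℝ (v s) x (EuclideanSpace.single 1 1) 2 ^ 2) := by
  have hpolx : curl (v s) x 2 = 0 := by
    have h := hpol x
    rwa [EuclideanSpace.inner_single_right, one_mul, conj_trivial] at h
  exact neg_laplacian_pressure_eq_of_poloidal_shear hcl (by rwa [isOpen_Ioo.interior_eq]) hpolx h0 h1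

/-- **Superharmonic pressure on elliptic slices.**  For a classical solution on a window `(t₀,0)` (in particular a
profile of the route's Type-I class with any of its classical pressures) and a slice `s ∈ (t₀,0)` that is poloidal
along `e₂` with a NONNEGATIVE shear ratio `m(y) ≥ 0` at every point (the closed elliptic regime, `Λ(y) ∉ (0,1)`):
`Δp(s) ≤ 0` everywhere on the slice. -/
theorem laplacian_pressure_nonpos_of_elliptic_slice {t₀ : ℝ} (hcl : IsClassicalNSSolutionOn (Ioo t₀ 0) 1 0 v p)
    {s : ℝ} (hs : s ∈ Ioo t₀ 0) (hpol : ∀ y, ⟪curl (v s) y, EuclideanSpace.single 2 1⟫ = 0)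
    {m : EuclideanSpace ℝ (Fin 3) → ℝ} (hm0 : ∀ y, 0 ≤ m y)
    (hm : ∀ y, fderiv ℝ (v s) y (EuclideanSpace.single 2 1) 0 = m y * fderiv ℝ (v s) y (EuclideanSpace.single 0 1) 2 ∧
      fderiv ℝ (v s) y (EuclideanSpace.single 2 1) 1 = m y * fderiv ℝ (v s) y (EuclideanSpace.single 1 1) 2) :
    ∀ y, (Δ (p s)) y ≤ 0 := by
  intro y
  have hpoly : curl (v s) y 2 = 0 := by
    have h := hpol y
    rwa [EuclideanSpace.inner_single_right, one_mul, conj_trivial] at h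
  exact laplacian_pressure_nonpos_of_shear_nonneg hcl (by rwa [isOpen_Ioo.interior_eq]) hpoly (hm0 y)
    (hm y).1 (hm y).2

/-- **Existence form on the class**: a profile of the route's Type-I class HAS a classical pressure on every window
`(t₀, 0)` (tree `IsTypeIAncientMild.exists_isClassicalNSSolutionOn_Ioo`), and on every elliptic poloidal slice of
that window it is superharmonic. -/
theorem exists_pressure_superharmonic_of_class (hrate : HasTypeITimeDecay C v)
    (hcont : ContinuousOn (uncurry v) (Iio (0 : ℝ) ×ˢ univ))
    (hmild : ∀ s t : ℝ, s < t → t < 0 → ∀ y,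
      v t y = UnboundedOperators.heatExtension (v s) (t - s) y - oseenDuhamel 1 s v v t y)
    (hdiv : ∀ t < 0, VectorCalculus.IsDivFree (v t)) {t₀ : ℝ} (ht₀ : t₀ < 0) :
    ∃ q : ℝ → EuclideanSpace ℝ (Fin 3) → ℝ, IsClassicalNSSolutionOn (Ioo t₀ 0) 1 0 v q ∧
      ∀ s ∈ Ioo t₀ 0, (∀ y, ⟪curl (v s) y, EuclideanSpace.single 2 1⟫ = 0) →
        ∀ (m : EuclideanSpace ℝ (Fin 3) → ℝ), (∀ y, 0 ≤ m y) →
          (∀ y, fderiv ℝ (v s) y (EuclideanSpace.single 2 1) 0 = m y * fderiv ℝ (v s) y (EuclideanSpace.single 0 1) 2 ∧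
            fderiv ℝ (v s) y (EuclideanSpace.single 2 1) 1 = m y * fderiv ℝ (v s) y (EuclideanSpace.single 1 1) 2) →
          ∀ y, (Δ (q s)) y ≤ 0 := by
  obtain ⟨q, hcl⟩ := (isTypeIAncientMild_of_class hrate hcont hmild hdiv).exists_isClassicalNSSolutionOn_Ioo ht₀
  exact ⟨q, hcl, fun s hs hpol m hm0 hm => laplacian_pressure_nonpos_of_elliptic_slice hcl hs hpol hm0 hm⟩

end Summit.NavierStokesRegularity.NavierStokesRegularity.Theorems.PoloidalWindowDoorPoloidalWindowRigidityPressureRegime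

end
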